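import Summits.HodgeConjecture.CorCM.IrreducibleOddWeightsHodgeGluingBlocks
import Summits.HodgeConjecture.CorCM.IrreducibleOddWeightsProductSpanConverse
import HarnessLib

/-!
# `Hg(∏_i A_i) = ∏_c Hg(∏_{κ i = c} A_i)` IFF the Hodge classes of `(∏_j A_{π₁ j}) × (∏_j A_{π₂ j})` are exterior products
# whenever `π₁`, `π₂` land in DISJOINT SETS OF BLOCKS — the block form of the `n`-ary Moonen–Zarhin equivalence

COR-CM (cell `pub-hodgecm2`, binder seat `b16` gen 60, count-neutral claim HODGE GLUING, file G8 — abstract `G`-slots, CM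
fields and their realisations; theorems only, no definition, no named fact, no `sorry`).  NEW as stated, hence under
`Summits/`.  HONEST FRAMING: an unconditional structure theorem on Hodge classes of products of CM abelian varieties;
`HC_CM` is neither used nor asserted.

Files G2/G7 (`cmFamilyRank_add_card_eq_iff_forall_hodgeClassesProductSpan`) treat families whose MEMBERS are additive.
Here the members are grouped into the BLOCKS of a partition `κ : I ↠ C` (e.g. the isogeny classes of simple factors of
given abelian varieties `X_c = ∏_{κ i = c} A_i`), nothing being assumed inside a block:

* §1 (abstract) **`IrrOdd.typeRank_sum_add_one_eq_of_fiber_add_card_eq_pred`** — block additivity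
  `rank(Σ) + |C| = Σ_c rank(Σ|_c) + 1` ⟹ for EVERY set of blocks `P` (with `P`, `¬P` both met): two-block additivity
  `rank(Σ|_{P∘κ} ⊔ Σ|_{¬P∘κ}) + 1 = rank Σ|_{P∘κ} + rank Σ|_{¬P∘κ}` (`Hg(X_P × X_{¬P}) = Hg(X_P) × Hg(X_{¬P})`) and block
  additivity of both halves (G5 had `P = {c₀}`); `IrrOdd.typeRank_sigmaType_fiber_pred_eq` (blocks of a sub-family).
* §2 CM dress; §3 **`hodgeClassesProductSpan_biproduct_of_cmFamilyRank_fiber_add_card_eq`** — block additivity + slot maps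
  `π₁`, `π₂` with `κ (π₁ j₁) ≠ κ (π₂ j₂)` always ⟹ `HodgeClassesProductSpan (⨁ A∘π₁) (⨁ A∘π₂)`; `hodgeConjectureFor_prod_…`.
* §4 **`exists_not_hodgeClassesProductSpan_of_cmFamilyRank_fiber_add_card_ne`** — if block additivity FAILS, some
  `π₁` inside one block and `π₂` inside other blocks give a product of copies WITHOUT the product-span property (minimal
  block-non-additive set of blocks, two-block converse of G7); **`cmFamilyRank_fiber_add_card_eq_iff_forall_hodgeClassesProductSpan`**
  — THE BLOCK EQUIVALENCE.  With `κ = id` this is G7; the sequel `IrreducibleOddWeightsHodgeGluingIntrinsicIff` reads it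
  on abelian varieties of CM type without CM data.

## References

* [MoonenZarhin1999LowDim] B. Moonen, Yu. Zarhin, *Hodge classes on abelian varieties of low dimension*, Math. Ann.
  315 (1999), §3 (3.1).
* [Gordon1999HodgeAVSurvey] B. B. Gordon, *A survey of the Hodge conjecture for abelian varieties*, 7.5–7.7.
* [Deligne1982HodgeCycles] P. Deligne, *Hodge cycles on abelian varieties*, LNM 900 (1982), I Ex. 3.7.
-/

set_option autoImplicit false

noncomputable section

open scoped BigOperators

open CategoryTheory CategoryTheory.Limits NumberField

namespace Summit.HodgeConjecture.CorCM

namespace IrrOdd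

open Literature.NumberTheory.ComplexMultiplication

universe w u v

variable {G : Type w} [Group G] {I : Type u} {E : I → Type v} [∀ i, MulAction G (E i)] [Fintype I]
  [∀ i, Fintype (E i)] [∀ i, Nonempty (E i)]

/-! ### §1 Abstract slots: block additivity splits along every set of blocks -/

omit [Fintype I] [∀ i, Fintype (E i)] [∀ i, Nonempty (E i)] in
/-- The blocks of the sub-family `(Φ_i)_{P (κ i)}` (partitioned by `κ` into the classes `c` with `P c`) have the ranks
of the blocks of `Φ`. [cite: Deligne1982HodgeCycles, I Ex. 3.7] -/
theorem typeRank_sigmaType_fiber_pred_eq {C : Type*} (Φ : ∀ i, Set (E i)) (κ : I → C) (P : C → Prop)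
    (c : {c // P c}) :
    typeRank G (sigmaType fun i : {i : {i // P (κ i)} // (⟨κ i.1, i.2⟩ : {c // P c}) = c} => Φ i.1.1) =
      typeRank G (sigmaType fun i : {i // κ i = c.1} => Φ i.1) := by
  set q : (Σ i : {i : {i // P (κ i)} // (⟨κ i.1, i.2⟩ : {c // P c}) = c}, E i.1.1) →
      Σ i : {i // κ i = c.1}, E i.1 := fun x => ⟨⟨x.1.1.1, congrArg Subtype.val x.1.2⟩, x.2⟩ with hq
  have hq_smul : ∀ (g : G) (x : Σ i : {i : {i // P (κ i)} // (⟨κ i.1, i.2⟩ : {c // P c}) = c}, E i.1.1),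
      q (g • x) = g • q x := fun g x => rfl
  have hq_surj : Function.Surjective q := by
    rintro ⟨⟨i, hi⟩, s⟩
    have hi' : P (κ i) := hi.symm ▸ c.2
    exact ⟨⟨⟨⟨i, hi'⟩, Subtype.ext hi⟩, s⟩, rfl⟩
  have hq_pre : q ⁻¹' (sigmaType fun i : {i // κ i = c.1} => Φ i.1) =
      sigmaType fun i : {i : {i // P (κ i)} // (⟨κ i.1, i.2⟩ : {c // P c}) = c} => Φ i.1.1 := rfl
  rw [← hq_pre]
  exact typeRank_preimage_eq_of_surjective (G := G) _ q hq_smul hq_surj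

/-- **BLOCK ADDITIVITY SPLITS ALONG EVERY SET OF BLOCKS.**  `G` permutes finite slots `E_i`, `Φ_i` are CM types for `ρ`,
`κ : I ↠ C` a partition with `rank(Σ) + |C| = Σ_c rank(Σ|_c) + 1` (`Hg(∏_i A_i) = ∏_c Hg(∏_{κ i = c} A_i)`), and `P` a
decidable set of blocks with both `P` and `¬P` met.  THEN (1) `rank(Σ|_{P∘κ} ⊔ Σ|_{¬P∘κ}) + 1 = rank Σ|_{P∘κ} + rank Σ|_{¬P∘κ}`
(`Hg(X_P × X_{¬P}) = Hg(X_P) × Hg(X_{¬P})`), and (2), (3) the two halves are block additive for the restricted partitions.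
(Sandwich: two-block subadditivity and block subadditivity of each half add up to the hypothesis.)
[cite: MoonenZarhin1999LowDim, §3 (3.1)] [cite: Gordon1999HodgeAVSurvey, 7.7] -/
theorem typeRank_sum_add_one_eq_of_fiber_add_card_eq_pred {C : Type*} [Fintype C] [DecidableEq C] {ρ : G}
    {Φ : ∀ i, Set (E i)} (h : ∀ i, IsCMTypeWith ρ (Φ i)) (κ : I → C) (hκ : Function.Surjective κ)
    (hadd : typeRank G (sigmaType Φ) + Fintype.card C =
      (∑ c, typeRank G (sigmaType fun i : {i // κ i = c} => Φ i.1)) + 1)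
    (P : C → Prop) [DecidablePred P] (hP : ∃ i, P (κ i)) (hnP : ∃ i, ¬P (κ i)) :
    typeRank G {z : (Σ i : {i // P (κ i)}, E i.1) ⊕ (Σ i : {i // ¬P (κ i)}, E i.1) |
        Sum.elim (· ∈ sigmaType fun i : {i // P (κ i)} => Φ i.1) (· ∈ sigmaType fun i : {i // ¬P (κ i)} => Φ i.1) z}
        + 1 =
      typeRank G (sigmaType fun i : {i // P (κ i)} => Φ i.1) +
        typeRank G (sigmaType fun i : {i // ¬P (κ i)} => Φ i.1) ∧
    typeRank G (sigmaType fun i : {i // P (κ i)} => Φ i.1) + Fintype.card {c // P c} =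
      (∑ c : {c // P c}, typeRank G (sigmaType fun i : {i // κ i = c.1} => Φ i.1)) + 1 ∧
    typeRank G (sigmaType fun i : {i // ¬P (κ i)} => Φ i.1) + Fintype.card {c // ¬P c} =
      (∑ c : {c // ¬P c}, typeRank G (sigmaType fun i : {i // κ i = c.1} => Φ i.1)) + 1 := by
  obtain ⟨i₁, hi₁⟩ := hP
  obtain ⟨i₂, hi₂⟩ := hnP
  haveI : Nonempty {i // P (κ i)} := ⟨⟨i₁, hi₁⟩⟩
  haveI : Nonempty {i // ¬P (κ i)} := ⟨⟨i₂, hi₂⟩⟩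
  haveI : Nonempty (Σ i : {i // P (κ i)}, E i.1) := ⟨⟨⟨i₁, hi₁⟩, Classical.arbitrary (E i₁)⟩⟩
  haveI : Nonempty (Σ i : {i // ¬P (κ i)}, E i.1) := ⟨⟨⟨i₂, hi₂⟩, Classical.arbitrary (E i₂)⟩⟩
  have hPt : IsCMTypeWith ρ (sigmaType fun i : {i // P (κ i)} => Φ i.1) := IsCMTypeWith.sigmaType fun i => h i.1
  have hNt : IsCMTypeWith ρ (sigmaType fun i : {i // ¬P (κ i)} => Φ i.1) := IsCMTypeWith.sigmaType fun i => h i.1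
  -- two-block subadditivity, the glued type being `Σ`
  have hle := typeRank_sum_add_one_le hPt hNt
  have hglue := typeRank_sum_subtype_eq (G := G) Φ (fun i => P (κ i))
  -- block subadditivity of the two halves
  set κ₁ : {i // P (κ i)} → {c // P c} := fun i => ⟨κ i.1, i.2⟩ with hκ₁
  set κ₂ : {i // ¬P (κ i)} → {c // ¬P c} := fun i => ⟨κ i.1, i.2⟩ with hκ₂
  have hκ₁s : Function.Surjective κ₁ := by
    rintro ⟨c, hc⟩
    obtain ⟨i, rfl⟩ := hκ c
    exact ⟨⟨i, hc⟩, rfl⟩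
  have hκ₂s : Function.Surjective κ₂ := by
    rintro ⟨c, hc⟩
    obtain ⟨i, rfl⟩ := hκ c
    exact ⟨⟨i, hc⟩, rfl⟩
  have h1 := typeRank_sigmaType_add_card_le_fiber (E := fun i : {i // P (κ i)} => E i.1) (fun i => h i.1) κ₁ hκ₁s
  have h2 := typeRank_sigmaType_add_card_le_fiber (E := fun i : {i // ¬P (κ i)} => E i.1) (fun i => h i.1) κ₂ hκ₂s
  have hf1 : ∀ c : {c // P c}, typeRank G (sigmaType fun i : {i : {i // P (κ i)} // κ₁ i = c} => Φ i.1.1) =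
      typeRank G (sigmaType fun i : {i // κ i = c.1} => Φ i.1) := fun c =>
    typeRank_sigmaType_fiber_pred_eq (G := G) Φ κ P c
  have hf2 : ∀ c : {c // ¬P c}, typeRank G (sigmaType fun i : {i : {i // ¬P (κ i)} // κ₂ i = c} => Φ i.1.1) =
      typeRank G (sigmaType fun i : {i // κ i = c.1} => Φ i.1) := fun c =>
    typeRank_sigmaType_fiber_pred_eq (G := G) Φ κ (fun c => ¬P c) c
  rw [Finset.sum_congr rfl fun c _ => hf1 c] at h1
  rw [Finset.sum_congr rfl fun c _ => hf2 c] at h2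
  -- splitting `Σ_c` and `|C|` along `P`
  have hsum : (∑ c : {c // P c}, typeRank G (sigmaType fun i : {i // κ i = c.1} => Φ i.1)) +
      ∑ c : {c // ¬P c}, typeRank G (sigmaType fun i : {i // κ i = c.1} => Φ i.1) =
        ∑ c, typeRank G (sigmaType fun i : {i // κ i = c} => Φ i.1) :=
    Fintype.sum_subtype_add_sum_subtype P fun c => typeRank G (sigmaType fun i : {i // κ i = c} => Φ i.1)
  have hcard : Fintype.card {c // P c} + Fintype.card {c // ¬P c} = Fintype.card C := by
    have h' := Fintype.sum_subtype_add_sum_subtype P fun _ : C => (1 : ℕ)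
    simpa only [Finset.sum_const, Finset.card_univ, smul_eq_mul, mul_one] using h'
  rw [hglue] at hle ⊢
  refine ⟨?_, ?_, ?_⟩ <;> omega

end IrrOdd

/-! ### §2 CM fields -/

open Literature.NumberTheory.ComplexMultiplication
open Literature.AlgebraicGeometry.Motives (AbelianVariety CMType)
open Literature.AlgebraicGeometry.Motives.AbelianVariety
open Literature.AlgebraicGeometry.HodgeTheory
open Literature.AlgebraicGeometry.ComplexMultiplication (IsCMTypeRealisation)
open Literature.AlgebraicGeometry.Milne1999 (flatIndex)
open Literature.AlgebraicGeometry.Pohlmann1968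

variable {I : Type} [Fintype I] {K : I → Type} [∀ i, Field (K i)] [∀ i, NumberField (K i)] [∀ i, IsCMField (K i)]
  {C : Type} [Fintype C] [DecidableEq C]

/-- **Block additivity splits along every set of blocks** for CM fields: `κ : I ↠ C`,
`cmFamilyRank Φ + |C| = Σ_c cmFamilyRank Φ|_{κ = c} + 1`, `P` a decidable set of blocks with `P`, `¬P` both met ⟹ the glued
type of `Φ|_{P∘κ}` and `Φ|_{¬P∘κ}` is two-block additive (`Hg(X_P × X_{¬P}) = Hg(X_P) × Hg(X_{¬P})`).
[cite: MoonenZarhin1999LowDim, §3 (3.1)] [cite: Gordon1999HodgeAVSurvey, 7.7] -/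
theorem typeRank_sum_add_one_eq_cmFamilyRank_of_fiber_add_card_eq_pred (Φ : ∀ i, CMType (K i)) (κ : I → C)
    (hκ : Function.Surjective κ)
    (hadd : CMAlgebra.cmFamilyRank Φ + Fintype.card C =
      (∑ c, CMAlgebra.cmFamilyRank fun i : {i // κ i = c} => Φ i.1) + 1)
    (P : C → Prop) [DecidablePred P] (hP : ∃ i, P (κ i)) (hnP : ∃ i, ¬P (κ i)) :
    typeRank (ℂ ≃+* ℂ) {z : (Σ i : {i // P (κ i)}, (K i.1 →+* ℂ)) ⊕ (Σ i : {i // ¬P (κ i)}, (K i.1 →+* ℂ)) |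
        Sum.elim (· ∈ CMAlgebra.familyType fun i : {i // P (κ i)} => Φ i.1)
          (· ∈ CMAlgebra.familyType fun i : {i // ¬P (κ i)} => Φ i.1) z} + 1 =
      CMAlgebra.cmFamilyRank (fun i : {i // P (κ i)} => Φ i.1) +
        CMAlgebra.cmFamilyRank (fun i : {i // ¬P (κ i)} => Φ i.1) :=
  (IrrOdd.typeRank_sum_add_one_eq_of_fiber_add_card_eq_pred (G := ℂ ≃+* ℂ) (E := fun i => K i →+* ℂ)
    (Φ := fun i => (Φ i).1) (fun i => isCMTypeWith_conj (Φ i)) κ hκ hadd P hP hnP).1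

/-! ### §3 Product span across disjoint sets of blocks -/

variable {Φ : ∀ i, CMType (K i)} {A : I → AbelianVariety ℂ} {ιA : ∀ i, 𝓞 (K i) →+* End (A i)}
  {θ : ∀ i, K i →+* Module.End ℂ (complexBetti (A i).X 1)}

/-- **`Hg(∏_i A_i) = ∏_c Hg(X_c)` ⟹ the Hodge classes of `(∏_j A_{π₁ j}) × (∏_j A_{π₂ j})` are exterior products whenever
`π₁`, `π₂` meet DISJOINT SETS OF BLOCKS.**  Realisations `A_i ⊨ (K_i; Φ_i)`, a partition `κ : I ↠ C` with block
additivity, slot maps `π₁ : J₁ → I`, `π₂ : J₂ → I` (non-empty finite sources) with `κ (π₁ j₁) ≠ κ (π₂ j₂)` always ⟹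
`HodgeClassesProductSpan (⨁_j A (π₁ j)) (⨁_j A (π₂ j))`.  (§2 with `P = κ-image of π₁`; G2's descent to slot families.)
[cite: MoonenZarhin1999LowDim, §3 (3.1)] [cite: Gordon1999HodgeAVSurvey, §3 Theorem (Imai, Murty) with proof, 7.7] -/
theorem hodgeClassesProductSpan_biproduct_of_cmFamilyRank_fiber_add_card_eq {J₁ J₂ : Type} [Fintype J₁] [Fintype J₂]
    [Nonempty J₁] [Nonempty J₂] (κ : I → C) (hκ : Function.Surjective κ)
    (hadd : CMAlgebra.cmFamilyRank Φ + Fintype.card C =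
      (∑ c, CMAlgebra.cmFamilyRank fun i : {i // κ i = c} => Φ i.1) + 1)
    (hA : ∀ i, IsCMTypeRealisation (Φ i) (A i) (ιA i) (θ i)) (π₁ : J₁ → I) (π₂ : J₂ → I)
    (hdisj : ∀ j₁ j₂, κ (π₁ j₁) ≠ κ (π₂ j₂)) :
    HodgeClassesProductSpan (⨁ fun j => A (π₁ j)) (⨁ fun j => A (π₂ j)) := by
  classical
  obtain ⟨j₁⟩ := ‹Nonempty J₁›
  obtain ⟨j₂⟩ := ‹Nonempty J₂›
  let P : C → Prop := fun c => ∃ j, κ (π₁ j) = c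
  have hP : ∃ i, P (κ i) := ⟨π₁ j₁, j₁, rfl⟩
  have hnP : ∃ i, ¬P (κ i) := ⟨π₂ j₂, fun ⟨j, hj⟩ => hdisj j j₂ hj⟩
  haveI : Nonempty {i // P (κ i)} := by obtain ⟨i, hi⟩ := hP; exact ⟨⟨i, hi⟩⟩
  haveI : Nonempty {i // ¬P (κ i)} := by obtain ⟨i, hi⟩ := hnP; exact ⟨⟨i, hi⟩⟩
  have hrank := typeRank_sum_add_one_eq_cmFamilyRank_of_fiber_add_card_eq_pred Φ κ hκ hadd P hP hnP
  exact hodgeClassesProductSpan_biproduct_comp_of_typeRank_add (K₁ := fun i : {i // P (κ i)} => K i.1)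
    (K₂ := fun i : {i // ¬P (κ i)} => K i.1) (Φ₁ := fun i : {i // P (κ i)} => Φ i.1)
    (Φ₂ := fun i : {i // ¬P (κ i)} => Φ i.1) (A₁ := fun i : {i // P (κ i)} => A i.1)
    (A₂ := fun i : {i // ¬P (κ i)} => A i.1) (fun i => hA i.1) (fun i => hA i.1) hrank
    (fun j => (⟨π₁ j, j, rfl⟩ : {i // P (κ i)})) (fun j => (⟨π₂ j, fun ⟨j', hj'⟩ => hdisj j' j hj'⟩ : {i // ¬P (κ i)}))

/-- **`HC(X) ∧ HC(Y) ⟹ HC(X × Y)` across disjoint sets of blocks**: `X ∼ ⨁_j A_{π₁ j}`, `Y ∼ ⨁_j A_{π₂ j}`, the two slot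
maps meeting disjoint sets of blocks of a block-additive partition. [cite: MoonenZarhin1999LowDim, §3 (3.1)]
[cite: vanGeemen1994HodgeAV, §3.5–3.7 Lemma 3.7 (p. 236)] -/
theorem hodgeConjectureFor_prod_of_cmFamilyRank_fiber_add_card_eq {J₁ J₂ : Type} [Fintype J₁] [Fintype J₂]
    [Nonempty J₁] [Nonempty J₂] (κ : I → C) (hκ : Function.Surjective κ)
    (hadd : CMAlgebra.cmFamilyRank Φ + Fintype.card C =
      (∑ c, CMAlgebra.cmFamilyRank fun i : {i // κ i = c} => Φ i.1) + 1)
    (hA : ∀ i, IsCMTypeRealisation (Φ i) (A i) (ιA i) (θ i)) (π₁ : J₁ → I) (π₂ : J₂ → I)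
    (hdisj : ∀ j₁ j₂, κ (π₁ j₁) ≠ κ (π₂ j₂)) {X Y : AbelianVariety ℂ} (hXi : IsIsogenous X (⨁ fun j => A (π₁ j)))
    (hYi : IsIsogenous Y (⨁ fun j => A (π₂ j))) (hHX : HodgeConjectureFor X.dim X.X)
    (hHY : HodgeConjectureFor Y.dim Y.X) : HodgeConjectureFor (X.prod Y).dim (X.prod Y).X :=
  hodgeConjectureFor_prod_of_productSpan X Y
    ((hodgeClassesProductSpan_biproduct_of_cmFamilyRank_fiber_add_card_eq κ hκ hadd hA π₁ π₂ hdisj).of_isIsogenous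
      hXi hYi) hHX hHY

/-! ### §4 The converse and the block equivalence -/

omit [Fintype I] [∀ i, NumberField (K i)] [∀ i, IsCMField (K i)] [Fintype C] in
/-- **Gluing the block `c₀ ∈ T` to the blocks `T ∖ {c₀}` gives the blocks `T`** (in Kubota rank).
[cite: Deligne1982HodgeCycles, I Ex. 3.7] -/
theorem typeRank_sum_fiber_erase_eq (Φ : ∀ i, CMType (K i)) (κ : I → C) (T : Finset C) {c₀ : C} (hc₀ : c₀ ∈ T) :
    typeRank (ℂ ≃+* ℂ) {z : (Σ i : {i // κ i = c₀}, (K i.1 →+* ℂ)) ⊕ (Σ i : {i // κ i ∈ T.erase c₀}, (K i.1 →+* ℂ)) |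
        Sum.elim (· ∈ CMAlgebra.familyType fun i : {i // κ i = c₀} => Φ i.1)
          (· ∈ CMAlgebra.familyType fun i : {i // κ i ∈ T.erase c₀} => Φ i.1) z} =
      CMAlgebra.cmFamilyRank fun i : {i // κ i ∈ T} => Φ i.1 := by
  set q : (Σ i : {i // κ i = c₀}, (K i.1 →+* ℂ)) ⊕ (Σ i : {i // κ i ∈ T.erase c₀}, (K i.1 →+* ℂ)) →
      Σ i : {i // κ i ∈ T}, (K i.1 →+* ℂ) :=
    Sum.elim (fun x => ⟨⟨x.1.1, x.1.2.symm ▸ hc₀⟩, x.2⟩)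
      (fun x => ⟨⟨x.1.1, Finset.mem_of_mem_erase x.1.2⟩, x.2⟩) with hq
  have hq_smul : ∀ (g : ℂ ≃+* ℂ)
      (z : (Σ i : {i // κ i = c₀}, (K i.1 →+* ℂ)) ⊕ (Σ i : {i // κ i ∈ T.erase c₀}, (K i.1 →+* ℂ))),
      q (g • z) = g • q z := by
    intro g z
    rcases z with ⟨⟨i, hi⟩, s⟩ | ⟨⟨i, hi⟩, s⟩ <;> rfl
  have hq_surj : Function.Surjective q := by
    rintro ⟨⟨i, hi⟩, s⟩
    by_cases h : κ i = c₀
    · exact ⟨Sum.inl ⟨⟨i, h⟩, s⟩, rfl⟩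
    · exact ⟨Sum.inr ⟨⟨i, Finset.mem_erase.2 ⟨h, hi⟩⟩, s⟩, rfl⟩
  have hq_pre : q ⁻¹' CMAlgebra.familyType (fun i : {i // κ i ∈ T} => Φ i.1) =
      {z | Sum.elim (· ∈ CMAlgebra.familyType fun i : {i // κ i = c₀} => Φ i.1)
        (· ∈ CMAlgebra.familyType fun i : {i // κ i ∈ T.erase c₀} => Φ i.1) z} := by
    ext z
    rcases z with ⟨⟨i, hi⟩, s⟩ | ⟨⟨i, hi⟩, s⟩ <;> rfl
  unfold CMAlgebra.cmFamilyRank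
  rw [← hq_pre]
  exact typeRank_preimage_eq_of_surjective (G := ℂ ≃+* ℂ) _ q hq_smul hq_surj

omit [Fintype I] [∀ i, NumberField (K i)] [∀ i, IsCMField (K i)] [Fintype C] [DecidableEq C] in
/-- The blocks of the sub-family `(Φ_i)_{κ i ∈ T}` have the ranks of the blocks of `Φ` (CM form). [cite: Deligne1982HodgeCycles, I Ex. 3.7] -/
theorem cmFamilyRank_fiber_mem_eq (Φ : ∀ i, CMType (K i)) (κ : I → C) (T : Finset C) (c : {c // c ∈ T}) :
    CMAlgebra.cmFamilyRank
        (fun i : {i : {i // κ i ∈ T} // (⟨κ i.1, i.2⟩ : {c // c ∈ T}) = c} => Φ i.1.1) =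
      CMAlgebra.cmFamilyRank fun i : {i // κ i = c.1} => Φ i.1 :=
  IrrOdd.typeRank_sigmaType_fiber_pred_eq (G := ℂ ≃+* ℂ) (E := fun i => K i →+* ℂ) (fun i => (Φ i).1) κ
    (fun c => c ∈ T) c

/-- **IF `Hg(∏_i A_i) ⊊ ∏_c Hg(X_c)` THEN SOME PRODUCT OF COPIES FROM ONE BLOCK AGAINST OTHER BLOCKS HAS AN EXCEPTIONAL
MIXED CLASS.**  `κ : I ↠ C` a partition whose block additivity FAILS (`cmFamilyRank Φ + |C| ≠ Σ_c cmFamilyRank Φ|_{κ=c} + 1`).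
Then there are a block `c₀` and slot maps `π₁ : Fin N₁ → I` inside the block `c₀`, `π₂ : Fin N₂ → I` inside blocks
`≠ c₀` (`N₁, N₂ ≥ 1`) with `¬ HodgeClassesProductSpan (⨁_j A_{π₁ j}) (⨁_j A_{π₂ j})`.  (A minimal block-non-additive set
of blocks `T₀` is two-block non-additive against any `c₀ ∈ T₀`; then G7's two-block converse.)
[cite: MoonenZarhin1999LowDim, §3 (3.1)] [cite: Gordon1999HodgeAVSurvey, 7.5–7.7] -/
theorem exists_not_hodgeClassesProductSpan_of_cmFamilyRank_fiber_add_card_ne [Nonempty I] (κ : I → C)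
    (hκ : Function.Surjective κ) (hA : ∀ i, IsCMTypeRealisation (Φ i) (A i) (ιA i) (θ i))
    (hne : CMAlgebra.cmFamilyRank Φ + Fintype.card C ≠
      (∑ c, CMAlgebra.cmFamilyRank fun i : {i // κ i = c} => Φ i.1) + 1) :
    ∃ (c₀ : C) (N₁ N₂ : ℕ) (_ : NeZero N₁) (_ : NeZero N₂) (π₁ : Fin N₁ → I) (π₂ : Fin N₂ → I),
      (∀ j, κ (π₁ j) = c₀) ∧ (∀ j, κ (π₂ j) ≠ c₀) ∧
        ¬ HodgeClassesProductSpan (⨁ fun j => A (π₁ j)) (⨁ fun j => A (π₂ j)) := by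
  classical
  -- block additivity of a set of blocks `T`
  let badd : Finset C → Prop := fun T =>
    CMAlgebra.cmFamilyRank (fun i : {i // κ i ∈ T} => Φ i.1) + T.card =
      (∑ c ∈ T, CMAlgebra.cmFamilyRank fun i : {i // κ i = c} => Φ i.1) + 1
  -- the a-priori inequality for non-empty `T`
  have hle : ∀ T : Finset C, T.Nonempty →
      CMAlgebra.cmFamilyRank (fun i : {i // κ i ∈ T} => Φ i.1) + T.card ≤
        (∑ c ∈ T, CMAlgebra.cmFamilyRank fun i : {i // κ i = c} => Φ i.1) + 1 := by
    intro T hT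
    obtain ⟨c₁, hc₁⟩ := hT
    obtain ⟨i₁, rfl⟩ := hκ c₁
    haveI : Nonempty {i // κ i ∈ T} := ⟨⟨i₁, hc₁⟩⟩
    haveI : ∀ i : {i // κ i ∈ T}, Nonempty (K i.1 →+* ℂ) := fun i => inferInstance
    set κT : {i // κ i ∈ T} → {c // c ∈ T} := fun i => ⟨κ i.1, i.2⟩ with hκT
    have hκTs : Function.Surjective κT := by
      rintro ⟨c, hc⟩
      obtain ⟨i, rfl⟩ := hκ c
      exact ⟨⟨i, hc⟩, rfl⟩
    have h := typeRank_sigmaType_add_card_le_fiber (G := ℂ ≃+* ℂ) (E := fun i : {i // κ i ∈ T} => K i.1 →+* ℂ)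
      (Φ := fun i => (Φ i.1).1) (fun i => isCMTypeWith_conj (Φ i.1)) κT hκTs
    have hf : ∀ c : {c // c ∈ T},
        typeRank (ℂ ≃+* ℂ) (sigmaType fun i : {i : {i // κ i ∈ T} // κT i = c} => (Φ i.1.1).1) =
          CMAlgebra.cmFamilyRank fun i : {i // κ i = c.1} => Φ i.1 := fun c => cmFamilyRank_fiber_mem_eq Φ κ T c
    rw [Finset.sum_congr rfl fun c _ => hf c, Fintype.card_coe,
      Finset.sum_coe_sort T fun c => CMAlgebra.cmFamilyRank fun i : {i // κ i = c} => Φ i.1] at h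
    exact h
  -- the whole partition is a block-non-additive set of blocks
  have huniv : ¬ badd Finset.univ := by
    intro h
    apply hne
    have hr : CMAlgebra.cmFamilyRank (fun i : {i // κ i ∈ (Finset.univ : Finset C)} => Φ i.1) =
        CMAlgebra.cmFamilyRank Φ :=
      (CMAlgebra.cmFamilyRank_comp_of_surjective (fun i : {i // κ i ∈ (Finset.univ : Finset C)} => Φ i.1)
        (π := fun i : I => (⟨i, Finset.mem_univ (κ i)⟩ : {i // κ i ∈ (Finset.univ : Finset C)}))
        fun j => ⟨j.1, rfl⟩).symm.trans rfl
    have h' : CMAlgebra.cmFamilyRank (fun i : {i // κ i ∈ (Finset.univ : Finset C)} => Φ i.1) + Finset.univ.card =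
        (∑ c ∈ Finset.univ, CMAlgebra.cmFamilyRank fun i : {i // κ i = c} => Φ i.1) + 1 := h
    rw [hr, Finset.card_univ] at h'
    exact h'
  -- a block-non-additive set of blocks of least cardinality among the non-empty ones
  haveI : Nonempty C := ⟨κ (Classical.arbitrary I)⟩
  have hex : ∃ m, ∃ T : Finset C, T.Nonempty ∧ T.card = m ∧ ¬ badd T :=
    ⟨_, Finset.univ, Finset.univ_nonempty, rfl, huniv⟩
  obtain ⟨T₀, hT₀ne, hT₀card, hT₀⟩ := Nat.find_spec hex
  have hmin : ∀ T : Finset C, T.Nonempty → T.card < T₀.card → badd T := by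
    intro T hT hlt
    by_contra hbad
    exact Nat.find_min hex (hT₀card ▸ hlt) ⟨T, hT, rfl, hbad⟩
  -- `T₀` has at least two blocks (a single block is trivially block additive)
  obtain ⟨c₀, hc₀⟩ := hT₀ne
  have hT₀2 : (T₀.erase c₀).Nonempty := by
    rw [← Finset.card_pos, Finset.card_erase_of_mem hc₀]
    by_contra h0
    have h1 : T₀.card = 1 := by have := Finset.card_pos.2 ⟨c₀, hc₀⟩; omega
    obtain ⟨c', hc'⟩ := Finset.card_eq_one.1 h1
    subst hc'
    apply hT₀
    change CMAlgebra.cmFamilyRank (fun i : {i // κ i ∈ ({c'} : Finset C)} => Φ i.1) + ({c'} : Finset C).card =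
      (∑ c ∈ ({c'} : Finset C), CMAlgebra.cmFamilyRank fun i : {i // κ i = c} => Φ i.1) + 1
    rw [Finset.card_singleton, Finset.sum_singleton]
    have hr : CMAlgebra.cmFamilyRank (fun i : {i // κ i ∈ ({c'} : Finset C)} => Φ i.1) =
        CMAlgebra.cmFamilyRank fun i : {i // κ i = c'} => Φ i.1 :=
      (CMAlgebra.cmFamilyRank_comp_of_surjective (fun i : {i // κ i ∈ ({c'} : Finset C)} => Φ i.1)
        (π := fun i : {i // κ i = c'} => (⟨i.1, Finset.mem_singleton.2 i.2⟩ : {i // κ i ∈ ({c'} : Finset C)}))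
        fun j => ⟨⟨j.1, Finset.mem_singleton.1 j.2⟩, rfl⟩).symm.trans rfl
    rw [hr]
  -- the two-block strict inequality for `({c₀}, T₀ ∖ {c₀})`
  obtain ⟨i₀, hi₀⟩ := hκ c₀
  haveI : Nonempty {i // κ i = c₀} := ⟨⟨i₀, hi₀⟩⟩
  haveI : Nonempty {i // κ i ∈ T₀.erase c₀} := by
    obtain ⟨c, hc⟩ := hT₀2
    obtain ⟨i, rfl⟩ := hκ c
    exact ⟨⟨i, hc⟩⟩
  have herase : badd (T₀.erase c₀) := hmin _ hT₀2 (Finset.card_erase_lt_of_mem hc₀)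
  have hlt : typeRank (ℂ ≃+* ℂ) {z : (Σ i : {i // κ i = c₀}, (K i.1 →+* ℂ)) ⊕
      (Σ i : {i // κ i ∈ T₀.erase c₀}, (K i.1 →+* ℂ)) |
      Sum.elim (· ∈ CMAlgebra.familyType fun i : {i // κ i = c₀} => Φ i.1)
        (· ∈ CMAlgebra.familyType fun i : {i // κ i ∈ T₀.erase c₀} => Φ i.1) z} + 1 <
      CMAlgebra.cmFamilyRank (fun i : {i // κ i = c₀} => Φ i.1) +
        CMAlgebra.cmFamilyRank (fun i : {i // κ i ∈ T₀.erase c₀} => Φ i.1) := by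
    rw [typeRank_sum_fiber_erase_eq Φ κ T₀ hc₀]
    have h2 : ¬ (CMAlgebra.cmFamilyRank (fun i : {i // κ i ∈ T₀} => Φ i.1) + T₀.card =
        (∑ c ∈ T₀, CMAlgebra.cmFamilyRank fun i : {i // κ i = c} => Φ i.1) + 1) := hT₀
    have h3 := hle T₀ ⟨c₀, hc₀⟩
    have h4 : CMAlgebra.cmFamilyRank (fun i : {i // κ i ∈ T₀.erase c₀} => Φ i.1) + (T₀.erase c₀).card =
        (∑ c ∈ T₀.erase c₀, CMAlgebra.cmFamilyRank fun i : {i // κ i = c} => Φ i.1) + 1 := herase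
    have h5 := Finset.add_sum_erase T₀ (fun c => CMAlgebra.cmFamilyRank fun i : {i // κ i = c} => Φ i.1) hc₀
    have h6 := Finset.card_erase_of_mem hc₀
    have h7 := Finset.card_pos.2 ⟨c₀, hc₀⟩
    omega
  -- the two-block converse
  obtain ⟨a, ha⟩ := exists_not_hodgeClassesProductSpan_of_typeRank_lt_fintype (K₁ := fun i : {i // κ i = c₀} => K i.1)
    (K₂ := fun i : {i // κ i ∈ T₀.erase c₀} => K i.1) (Φ₁ := fun i : {i // κ i = c₀} => Φ i.1)
    (Φ₂ := fun i : {i // κ i ∈ T₀.erase c₀} => Φ i.1) (A₁ := fun i : {i // κ i = c₀} => A i.1)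
    (A₂ := fun i : {i // κ i ∈ T₀.erase c₀} => A i.1) (fun i => hA i.1) (fun i => hA i.1) hlt
  refine ⟨c₀, (a + 1) * Fintype.card {i // κ i = c₀}, (a + 1) * Fintype.card {i // κ i ∈ T₀.erase c₀},
    ⟨Nat.mul_ne_zero (Nat.succ_ne_zero a) Fintype.card_ne_zero⟩,
    ⟨Nat.mul_ne_zero (Nat.succ_ne_zero a) Fintype.card_ne_zero⟩,
    fun j => ((Fintype.equivFin {i // κ i = c₀}).symm (flatIndex a j)).1,
    fun j => ((Fintype.equivFin {i // κ i ∈ T₀.erase c₀}).symm (flatIndex a j)).1,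
    fun j => ((Fintype.equivFin {i // κ i = c₀}).symm (flatIndex a j)).2, fun j => ?_, ha⟩
  exact (Finset.mem_erase.1 ((Fintype.equivFin {i // κ i ∈ T₀.erase c₀}).symm (flatIndex a j)).2).1

/-- **THE BLOCK EQUIVALENCE.**  Realisations `A_i ⊨ (K_i; Φ_i)` (`i ∈ I` finite non-empty), a partition `κ : I ↠ C`.
`Hg(∏_i A_i) = ∏_c Hg(∏_{κ i = c} A_i)` (block additivity) IF AND ONLY IF for all `N₁, N₂ ≥ 1` and all slot maps
`π₁ : Fin N₁ → I`, `π₂ : Fin N₂ → I` meeting DISJOINT sets of blocks, `HodgeClassesProductSpan (⨁_j A_{π₁ j}) (⨁_j A_{π₂ j})`.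
[cite: MoonenZarhin1999LowDim, §3 (3.1)] [cite: Gordon1999HodgeAVSurvey, 7.5–7.7] -/
theorem cmFamilyRank_fiber_add_card_eq_iff_forall_hodgeClassesProductSpan [Nonempty I] (κ : I → C)
    (hκ : Function.Surjective κ) (hA : ∀ i, IsCMTypeRealisation (Φ i) (A i) (ιA i) (θ i)) :
    CMAlgebra.cmFamilyRank Φ + Fintype.card C = (∑ c, CMAlgebra.cmFamilyRank fun i : {i // κ i = c} => Φ i.1) + 1 ↔
      ∀ (N₁ N₂ : ℕ) [NeZero N₁] [NeZero N₂] (π₁ : Fin N₁ → I) (π₂ : Fin N₂ → I),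
        (∀ j₁ j₂, κ (π₁ j₁) ≠ κ (π₂ j₂)) → HodgeClassesProductSpan (⨁ fun j => A (π₁ j)) (⨁ fun j => A (π₂ j)) := by
  refine ⟨fun hadd N₁ N₂ _ _ π₁ π₂ hdisj =>
    hodgeClassesProductSpan_biproduct_of_cmFamilyRank_fiber_add_card_eq κ hκ hadd hA π₁ π₂ hdisj, fun h => ?_⟩
  by_contra hne
  obtain ⟨c₀, N₁, N₂, hN₁, hN₂, π₁, π₂, h₁, h₂, hnot⟩ :=
    exists_not_hodgeClassesProductSpan_of_cmFamilyRank_fiber_add_card_ne κ hκ hA hne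
  exact hnot (h N₁ N₂ π₁ π₂ fun j₁ j₂ hj => h₂ j₂ ((h₁ j₁).symm.trans hj).symm)

end Summit.HodgeConjecture.CorCM

end
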